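import Mathlib
import Summits.ValiantsHypothesis.ValiantsHypothesis.Theorems.GeneratorObstructionsPowGenDegreeQPRowTwoReduction
import Summits.ValiantsHypothesis.ValiantsHypothesis.Theorems.GeneratorObstructionsPowGenDegreeQPTraceTwoDiagonal

/-!
# K2 `PowGenDegreeQP` (stmt-ValiantsHypothesis-11655), line `trace-side-regimes`, row `m = 2`:
# Gram matrices of quadrics and the principal-minor highest-weight vectors (input `hfund`)

Helper file (`--supports stmt-ValiantsHypothesis-11655`).  Of the three inputs of
`…PowGenDegreeQPRowTwoReduction.rowTwo_bound_of_sign_of_fund` for the row `m = 2` (quadrics) of the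
window of K2, (i) + `hsign` were discharged in `…PowGenDegreeQPTraceTwoDiagonal`; this file
discharges `hfund` and leaves the row open modulo the Borel (Cholesky) density alone
(`rowTwo_bound_of_dense`).

* §1 Quadrics `∑_{i,j} S_{ij} X_i X_j`: `linSubst_quadric` (`A · ∑ S_{ij} X_i X_j = ∑ (A S Aᵀ)_{ab}
  X_a X_b`), `coeff_quadric` (Gram/Hessian matrix `= S + Sᵀ`), diagonal quadrics, pull-back along
  `h₀`.
* §2 The principal minor `P_t` of the Gram matrix on the final segment `{u ≥ t}` as a polynomial
  function on `Sym²` (determinant of the polynomial matrix `((1+δ_{ij}) X_{x_i x_j})_{i,j ≥ t}`), its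
  values at quadrics (`aeval_formCoeff_quadric_minorPoly`), and the covariance
  `det((M S Mᵀ)|_{≥t}) = (∏_{u ≥ t} M_{uu})² det(S|_{≥t})` for upper triangular `M`
  (`det_submatrix_mul_mul_transpose_of_blockTriangular`), `χ_t(g) = (∏_{u≥t} (g⁻¹)_{uu})²`.
* §3 `minorPoly_mem_highestWeightSpace`: `[P_t]` is a highest-weight vector of weight
  `-2·𝟙_{≥ t}` in `k[Δ_2 f]` for every quadric `f` (checked on values at orbit points);
  `hfund_of_linSubstRep_eq_diagonal`: if `h₀ · f = ∑ c_u X_u²` with all `c_u ≠ 0` then every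
  `-2·𝟙_{≥ t}` OCCURS (`P_t(h₀ · f) = ∏_{u≥t} 2c_u ≠ 0`); `hfund_powFormLex_two` for `tr X_n²`;
  `rowTwo_bound_of_dense`: the K2 bound of the row `m = 2` (exponent `c + 1`) modulo `hdense` only.

Honest label: classical covariants of quadrics (Goodman–Wallach §5.7: `k[Sym²]^{N⁺} = k[Δ_1,…,Δ_N]`,
here only "each `Δ_k` is a highest-weight vector"); rows `m ≥ 2` of both registered stubs OPEN.
-/

namespace Summit.ValiantsHypothesis.ValiantsHypothesis.Theorems.GeneratorObstructions.PowGenDegreeQP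

open MvPolynomial
open scoped Matrix
open Literature.NumberTheory.DiophantineGeometry Literature.Computability.AlgebraicComplexity

-- `Summit.ValiantsHypothesis.ValiantsHypothesis.…` is the tree's mandated single-conjunct layout.
set_option linter.dupNamespace false

noncomputable section

section Quadric

variable {σ k : Type*} [Fintype σ] [DecidableEq σ] [Field k]

/-! ## 1. Quadrics `∑ S_{ij} X_i X_j`: substitution and coefficients -/

omit [DecidableEq σ] in
/-- **Linear substitution of a quadric**: `A · (∑_{i,j} S_{ij} X_i X_j) = ∑_{a,b} (A S Aᵀ)_{ab} X_a X_b`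
(the tree's substitution `X_i ↦ ∑_a A_{ai} X_a`). [folklore] -/
theorem linSubst_quadric (A S : Matrix σ σ k) :
    linSubst σ k A (∑ i, ∑ j, S i j • (X i * X j : MvPolynomial σ k)) =
      ∑ a, ∑ b, (A * S * Aᵀ) a b • (X a * X b : MvPolynomial σ k) := by
  have hL : linSubst σ k A (∑ i, ∑ j, S i j • (X i * X j : MvPolynomial σ k)) =
      ∑ i, ∑ j, ∑ a, ∑ b, (S i j * (A a i * A b j)) • (X a * X b : MvPolynomial σ k) := by
    simp only [map_sum, map_smul, map_mul, linSubst_X]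
    refine Finset.sum_congr rfl fun i _ => Finset.sum_congr rfl fun j _ => ?_
    rw [Finset.sum_mul_sum, Finset.smul_sum]
    refine Finset.sum_congr rfl fun a _ => ?_
    rw [Finset.smul_sum]
    refine Finset.sum_congr rfl fun b _ => ?_
    rw [smul_mul_smul_comm, smul_smul]
  have hR : ∑ a, ∑ b, (A * S * Aᵀ) a b • (X a * X b : MvPolynomial σ k) =
      ∑ a, ∑ b, ∑ i, ∑ j, (S i j * (A a i * A b j)) • (X a * X b : MvPolynomial σ k) := by
    refine Finset.sum_congr rfl fun a _ => Finset.sum_congr rfl fun b _ => ?_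
    simp only [Matrix.mul_apply, Matrix.transpose_apply, Finset.sum_mul, Finset.sum_smul]
    rw [Finset.sum_comm]
    refine Finset.sum_congr rfl fun i _ => Finset.sum_congr rfl fun j _ => ?_
    congr 1
    ring
  rw [hL, hR]
  calc (∑ i, ∑ j, ∑ a, ∑ b, (S i j * (A a i * A b j)) • (X a * X b : MvPolynomial σ k))
      = ∑ i, ∑ a, ∑ b, ∑ j, (S i j * (A a i * A b j)) • (X a * X b : MvPolynomial σ k) := by
        refine Finset.sum_congr rfl fun i _ => ?_
        conv_lhs => rw [Finset.sum_comm]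
        refine Finset.sum_congr rfl fun a _ => ?_
        conv_lhs => rw [Finset.sum_comm]
    _ = ∑ a, ∑ i, ∑ b, ∑ j, (S i j * (A a i * A b j)) • (X a * X b : MvPolynomial σ k) :=
        Finset.sum_comm
    _ = ∑ a, ∑ b, ∑ i, ∑ j, (S i j * (A a i * A b j)) • (X a * X b : MvPolynomial σ k) := by
        refine Finset.sum_congr rfl fun a _ => ?_
        conv_lhs => rw [Finset.sum_comm]

/-- **Coefficients of a quadric**: the coefficient of `X_a X_b` in `∑_{i,j} S_{ij} X_i X_j` is
`S_{aa}` if `a = b` and `S_{ab} + S_{ba}` otherwise. [folklore] -/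
theorem coeff_quadric (S : Matrix σ σ k) (a b : σ) :
    coeff (Finsupp.single a 1 + Finsupp.single b 1) (∑ i, ∑ j, S i j • (X i * X j : MvPolynomial σ k)) =
      if a = b then S a b else S a b + S b a := by
  classical
  have hX : ∀ i j : σ, (X i * X j : MvPolynomial σ k) =
      monomial (Finsupp.single i 1 + Finsupp.single j 1) 1 := by
    intro i j
    rw [X, X, monomial_mul, mul_one]
  simp only [hX, coeff_sum, coeff_smul, coeff_monomial, smul_eq_mul, mul_ite, mul_one, mul_zero]
  rw [← Fintype.sum_prod_type' (fun i j => if Finsupp.single i 1 + Finsupp.single j 1 =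
      Finsupp.single a 1 + Finsupp.single b 1 then S i j else 0)]
  rw [← Finset.sum_filter]
  have hfilter : (Finset.univ.filter fun p : σ × σ =>
      Finsupp.single p.1 1 + Finsupp.single p.2 1 = Finsupp.single a 1 + Finsupp.single b 1) =
      ({(a, b), (b, a)} : Finset (σ × σ)) := by
    ext p
    simp only [Finset.mem_filter, Finset.mem_univ, true_and, Finset.mem_insert,
      Finset.mem_singleton]
    constructor
    · intro h
      rcases (Finsupp.single_add_single_eq_single_add_single one_ne_zero one_ne_zero).mp h with
        ⟨h1, h2⟩ | ⟨-, h1, h2⟩ | ⟨h0, -, -⟩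
      · exact Or.inl (Prod.ext h1 h2)
      · exact Or.inr (Prod.ext h1 h2)
      · exact absurd h0 (by norm_num)
    · rintro (rfl | rfl)
      · rfl
      · exact add_comm _ _
  rw [hfilter]
  by_cases hab : a = b
  · subst hab
    rw [if_pos rfl, Finset.insert_eq_of_mem (Finset.mem_singleton_self _), Finset.sum_singleton]
  · rw [if_neg hab, Finset.sum_pair (fun h => hab (Prod.mk.inj h).1)]

/-- A diagonal quadric is a quadric: `∑_u c_u X_u² = ∑_{i,j} (diag c)_{ij} X_i X_j`. [folklore] -/
theorem sum_smul_X_sq_eq_quadric (c : σ → k) :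
    (∑ u, c u • (X u : MvPolynomial σ k) ^ 2) =
      ∑ i, ∑ j, (Matrix.diagonal c) i j • (X i * X j : MvPolynomial σ k) := by
  classical
  refine Finset.sum_congr rfl fun i _ => ?_
  rw [Finset.sum_eq_single i]
  · rw [Matrix.diagonal_apply_eq, sq]
  · intro j _ hj
    rw [Matrix.diagonal_apply_ne _ (Ne.symm hj), zero_smul]
  · intro h; exact absurd (Finset.mem_univ i) h

/-- Pulling a form back along `h₀`: if `h₀ · f = ∑_u c_u X_u²` then
`f = ∑_{i,j} (h₀⁻¹ (diag c) h₀⁻ᵀ)_{ij} X_i X_j`. [folklore] -/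
theorem eq_quadric_of_linSubstRep_eq_diagonal (f : MvPolynomial σ k) (h₀ : GL σ k) (c : σ → k)
    (h : linSubstRep σ k h₀ f = ∑ u, c u • (X u : MvPolynomial σ k) ^ 2) :
    f = ∑ i, ∑ j, (((h₀⁻¹ : GL σ k) : Matrix σ σ k) * Matrix.diagonal c *
      ((h₀⁻¹ : GL σ k) : Matrix σ σ k)ᵀ) i j • (X i * X j : MvPolynomial σ k) := by
  have h1 := congrArg (linSubstRep σ k h₀⁻¹) h
  rwa [← Module.End.mul_apply, ← map_mul, inv_mul_cancel, map_one, Module.End.one_apply,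
    sum_smul_X_sq_eq_quadric, linSubstRep_apply, linSubst_quadric] at h1

/-- Orbit points of a quadric are quadrics: `g · ∑ S_{ij} X_i X_j = ∑ (g S gᵀ)_{ab} X_a X_b`.
[folklore] -/
theorem linSubstRep_quadric (g : GL σ k) (S : Matrix σ σ k) :
    linSubstRep σ k g (∑ i, ∑ j, S i j • (X i * X j : MvPolynomial σ k)) =
      ∑ a, ∑ b, ((g : Matrix σ σ k) * S * (g : Matrix σ σ k)ᵀ) a b •
        (X a * X b : MvPolynomial σ k) := by
  rw [linSubstRep_apply, linSubst_quadric]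

/-- The monomial `X_i X_j` has degree `2`. [folklore] -/
theorem single_add_single_mem_degMonomials_two (i j : σ) :
    Finsupp.single i 1 + Finsupp.single j 1 ∈ degMonomials σ 2 := by
  rw [mem_degMonomials_iff, map_add, Finsupp.degree_single, Finsupp.degree_single]

end Quadric

section Minors

variable {σ k : Type*} [Fintype σ] [LinearOrder σ] [Field k]

/-! ## 2. Principal minors of the Gram matrix on final segments -/

/-- **Evaluation of the principal-minor polynomial**: the determinant of the polynomial matrix
`((1 + δ_{ij}) · X_{x_i x_j})_{i,j ≥ t}` on `Sym²` evaluates at a form `q` to the principal minor on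
the final segment `{u ≥ t}` of the Gram (Hessian) matrix `((1 + δ_{ij}) · coeff_{x_i x_j} q)`.
[folklore] -/
theorem aeval_formCoeff_minorPoly (q : MvPolynomial σ k) (t : σ) :
    aeval (formCoeff 2 q)
      (Matrix.of fun i j : {u : σ // t ≤ u} =>
        ((if i.1 = j.1 then (2 : k) else 1) •
          X (⟨Finsupp.single i.1 1 + Finsupp.single j.1 1,
            single_add_single_mem_degMonomials_two i.1 j.1⟩ : DegIdx σ 2) :
          MvPolynomial (DegIdx σ 2) k)).det =
      (Matrix.of fun i j : {u : σ // t ≤ u} =>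
        (if i.1 = j.1 then (2 : k) else 1) *
          coeff (Finsupp.single i.1 1 + Finsupp.single j.1 1) q).det := by
  rw [AlgHom.map_det]
  congr 1
  ext i j
  simp only [AlgHom.mapMatrix_apply, Matrix.map_apply, Matrix.of_apply, map_smul, aeval_X,
    formCoeff_apply, smul_eq_mul]

/-- At a quadric `∑ S_{ij} X_i X_j` the Gram matrix is `S + Sᵀ`, so the principal-minor polynomial
evaluates to `det ((S + Sᵀ)|_{≥ t})`. [folklore] -/
theorem aeval_formCoeff_quadric_minorPoly (S : Matrix σ σ k) (t : σ) :
    aeval (formCoeff 2 (∑ i, ∑ j, S i j • (X i * X j : MvPolynomial σ k)))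
      (Matrix.of fun i j : {u : σ // t ≤ u} =>
        ((if i.1 = j.1 then (2 : k) else 1) •
          X (⟨Finsupp.single i.1 1 + Finsupp.single j.1 1,
            single_add_single_mem_degMonomials_two i.1 j.1⟩ : DegIdx σ 2) :
          MvPolynomial (DegIdx σ 2) k)).det =
      ((S + Sᵀ).submatrix (fun u : {u : σ // t ≤ u} => u.1) (fun u => u.1)).det := by
  rw [aeval_formCoeff_minorPoly]
  congr 1
  ext i j
  rw [Matrix.of_apply, coeff_quadric, Matrix.submatrix_apply, Matrix.add_apply,
    Matrix.transpose_apply]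
  split_ifs with h
  · rw [h]; ring
  · ring

/-- **Final segments see only the final block of an upper triangular matrix**:
`(M S Mᵀ)|_{≥ t} = M|_{≥ t} S|_{≥ t} (M|_{≥ t})ᵀ` for `M` upper triangular. [folklore] -/
theorem submatrix_mul_mul_transpose_of_blockTriangular {M : Matrix σ σ k}
    (hM : M.BlockTriangular id) (S : Matrix σ σ k) (t : σ) :
    (M * S * Mᵀ).submatrix (fun u : {u : σ // t ≤ u} => u.1) (fun u => u.1) =
      M.submatrix (fun u : {u : σ // t ≤ u} => u.1) (fun u => u.1) *
        S.submatrix (fun u : {u : σ // t ≤ u} => u.1) (fun u => u.1) *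
        (M.submatrix (fun u : {u : σ // t ≤ u} => u.1) (fun u => u.1))ᵀ := by
  have hvan : ∀ (a : {u : σ // t ≤ u}) (i : σ), ¬t ≤ i → M a.1 i = 0 := by
    intro a i hi
    exact hM (show id i < id a.1 from lt_of_lt_of_le (not_le.mp hi) a.2)
  have hsum : ∀ (φ : σ → k), (∀ i, ¬t ≤ i → φ i = 0) →
      ∑ i, φ i = ∑ i : {u : σ // t ≤ u}, φ i.1 := by
    intro φ hφ
    rw [← Finset.sum_subset (Finset.filter_subset (fun i => t ≤ i) Finset.univ)
      (fun i _ hi => hφ i (fun h => hi (Finset.mem_filter.mpr ⟨Finset.mem_univ i, h⟩)))]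
    exact Finset.sum_subtype _ (fun i => by simp) φ
  ext a b
  simp only [Matrix.submatrix_apply, Matrix.mul_apply, Matrix.transpose_apply]
  rw [hsum _ (fun j hj => by rw [hvan b j hj, mul_zero])]
  refine Finset.sum_congr rfl fun j _ => ?_
  rw [hsum _ (fun i hi => by rw [hvan a i hi, zero_mul])]

/-- The final block of an upper triangular matrix is upper triangular with determinant the product
of its diagonal entries. [folklore] -/
theorem det_submatrix_of_blockTriangular {M : Matrix σ σ k} (hM : M.BlockTriangular id) (t : σ) :
    (M.submatrix (fun u : {u : σ // t ≤ u} => u.1) (fun u => u.1)).det =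
      ∏ u : {u : σ // t ≤ u}, M u.1 u.1 := by
  have htri : (M.submatrix (fun u : {u : σ // t ≤ u} => u.1) (fun u => u.1)).BlockTriangular id :=
    fun i j hij => hM.submatrix hij
  rw [Matrix.det_of_upperTriangular htri]
  rfl

/-- **Covariance of the final-segment principal minors**: for `M` upper triangular,
`det ((M S Mᵀ)|_{≥ t}) = (∏_{u ≥ t} M_{uu})² · det (S|_{≥ t})`. [folklore] -/
theorem det_submatrix_mul_mul_transpose_of_blockTriangular {M : Matrix σ σ k}
    (hM : M.BlockTriangular id) (S : Matrix σ σ k) (t : σ) :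
    ((M * S * Mᵀ).submatrix (fun u : {u : σ // t ≤ u} => u.1) (fun u => u.1)).det =
      (∏ u : {u : σ // t ≤ u}, M u.1 u.1) ^ 2 *
        (S.submatrix (fun u : {u : σ // t ≤ u} => u.1) (fun u => u.1)).det := by
  rw [submatrix_mul_mul_transpose_of_blockTriangular hM, Matrix.det_mul, Matrix.det_mul,
    Matrix.det_transpose, det_submatrix_of_blockTriangular hM]
  ring

/-- The fundamental weight `-2·𝟙_{≥ t}` evaluated on an upper triangular `g`:
`χ(g) = (∏_{u ≥ t} (g⁻¹)_{uu})²`. [folklore] -/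
theorem weightChar_fund_eq (t : σ) {g : GL σ k} (hg : IsUpperTriangular g) :
    weightChar (fun v => if t ≤ v then (-2 : ℤ) else 0) g =
      (∏ u : {u : σ // t ≤ u}, ((g⁻¹ : GL σ k) : Matrix σ σ k) u.1 u.1) ^ 2 := by
  rw [weightChar]
  have h1 : (∏ i, (g : Matrix σ σ k) i i ^ ((fun v => if t ≤ v then (-2 : ℤ) else 0) i)) =
      ∏ i, (if t ≤ i then ((g : Matrix σ σ k) i i ^ 2)⁻¹ else 1) := by
    refine Finset.prod_congr rfl fun i _ => ?_
    simp only
    split_ifs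
    · rw [zpow_neg, zpow_ofNat]
    · rw [zpow_zero]
  rw [h1, ← Finset.prod_filter, Finset.prod_subtype (Finset.univ.filter fun i => t ≤ i)
    (p := fun i => t ≤ i) (fun i => by simp), ← Finset.prod_pow]
  refine Finset.prod_congr rfl fun u _ => ?_
  rw [inv_apply_diag_of_isUpperTriangular' hg, inv_pow]

/-! ## 3. The principal minors are highest-weight vectors of the orbit closure of a quadric -/

/-- **Principal minors of the Gram matrix on final segments are highest-weight vectors** of weight
`-2·𝟙_{≥ t}` in the coordinate ring of the orbit closure of any quadric `f = ∑ S₀_{ij} X_i X_j`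
(checked on values at orbit points: `P_t(g⁻¹ h · f) = χ_t(g) P_t(h · f)` for upper triangular `g`,
by `det((M Y Mᵀ)|_{≥t}) = (∏_{≥t} M_{uu})² det(Y|_{≥t})`). Goodman–Wallach §5.7 (the
`N⁺`-invariants `Δ_k` of `k[Sym²]`). [folklore] -/
theorem minorPoly_mem_highestWeightSpace (S₀ : Matrix σ σ k) (t : σ) :
    Ideal.Quotient.mk (orbitVanishingIdeal (∑ i, ∑ j, S₀ i j • (X i * X j : MvPolynomial σ k)) 2)
      (Matrix.of fun i j : {u : σ // t ≤ u} =>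
        ((if i.1 = j.1 then (2 : k) else 1) •
          X (⟨Finsupp.single i.1 1 + Finsupp.single j.1 1,
            single_add_single_mem_degMonomials_two i.1 j.1⟩ : DegIdx σ 2) :
          MvPolynomial (DegIdx σ 2) k)).det ∈
      highestWeightSpace (orbitCoordRep (∑ i, ∑ j, S₀ i j • (X i * X j : MvPolynomial σ k)) 2)
        (fun v => if t ≤ v then (-2 : ℤ) else 0) := by
  set f : MvPolynomial σ k := ∑ i, ∑ j, S₀ i j • (X i * X j : MvPolynomial σ k) with hf
  set P : MvPolynomial (DegIdx σ 2) k := (Matrix.of fun i j : {u : σ // t ≤ u} =>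
        ((if i.1 = j.1 then (2 : k) else 1) •
          X (⟨Finsupp.single i.1 1 + Finsupp.single j.1 1,
            single_add_single_mem_degMonomials_two i.1 j.1⟩ : DegIdx σ 2) :
          MvPolynomial (DegIdx σ 2) k)).det with hP
  intro g hg
  rw [orbitCoordRep_apply, orbitCoordSubst_mk]
  have hmk : Ideal.Quotient.mk (orbitVanishingIdeal f 2) (coordSubst 2 g P) =
      Ideal.Quotient.mk (orbitVanishingIdeal f 2)
        (weightChar (fun v => if t ≤ v then (-2 : ℤ) else 0) g • P) := by
    rw [Ideal.Quotient.eq, mem_orbitVanishingIdeal_iff]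
    intro h
    rw [map_sub, map_smul, aeval_formCoeff_coordSubst, sub_eq_zero, smul_eq_mul]
    have hU : ((g⁻¹ : GL σ k) : Matrix σ σ k).BlockTriangular id := (borelSubgroup σ k).inv_mem hg
    rw [hf, linSubstRep_quadric, linSubstRep_quadric, hP, aeval_formCoeff_quadric_minorPoly,
      aeval_formCoeff_quadric_minorPoly]
    set M : Matrix σ σ k := ((g⁻¹ : GL σ k) : Matrix σ σ k) with hM
    set N : Matrix σ σ k := (h : Matrix σ σ k) * S₀ * (h : Matrix σ σ k)ᵀ with hN
    have hX : M * N * Mᵀ + (M * N * Mᵀ)ᵀ = M * (N + Nᵀ) * Mᵀ := by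
      rw [Matrix.transpose_mul, Matrix.transpose_mul, Matrix.transpose_transpose, Matrix.mul_add,
        Matrix.add_mul, Matrix.mul_assoc M Nᵀ Mᵀ]
    rw [hX, det_submatrix_mul_mul_transpose_of_blockTriangular hU, weightChar_fund_eq t hg]
  rw [hmk]
  exact map_smul (Ideal.Quotient.mkₐ k (orbitVanishingIdeal f 2)) _ P

/-- At the diagonal quadric `∑_u c_u X_u²` the principal-minor polynomial evaluates to
`∏_{u ≥ t} 2 c_u`. [folklore] -/
theorem aeval_formCoeff_diagonal_minorPoly (c : σ → k) (t : σ) :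
    aeval (formCoeff 2 (∑ u, c u • (X u : MvPolynomial σ k) ^ 2))
      (Matrix.of fun i j : {u : σ // t ≤ u} =>
        ((if i.1 = j.1 then (2 : k) else 1) •
          X (⟨Finsupp.single i.1 1 + Finsupp.single j.1 1,
            single_add_single_mem_degMonomials_two i.1 j.1⟩ : DegIdx σ 2) :
          MvPolynomial (DegIdx σ 2) k)).det =
      ∏ u : {u : σ // t ≤ u}, 2 * c u.1 := by
  rw [sum_smul_X_sq_eq_quadric, aeval_formCoeff_quadric_minorPoly, Matrix.diagonal_transpose,
    Matrix.diagonal_add,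
    Matrix.submatrix_diagonal (fun i => c i + c i) (fun u : {u : σ // t ≤ u} => u.1)
      Subtype.val_injective, Matrix.det_diagonal]
  refine Finset.prod_congr rfl fun u _ => ?_
  simp only [Function.comp_apply]
  ring

/-- **hfund, general form**: if some `h₀ ∈ GL` moves `f` to a full-rank diagonal quadric
`h₀ · f = ∑_u c_u X_u²` (`c_u ≠ 0`, characteristic zero), then every fundamental even weight
`-2·𝟙_{≥ t}` occurs in `k[Δ_2 f]`: the principal minor of the Gram matrix on `{u ≥ t}` is a
highest-weight vector of that weight and does not vanish at `h₀ · f`. This is hypothesis `hfund` of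
`rowTwo_bound_of_sign_of_fund`. Goodman–Wallach §5.7. [folklore] -/
theorem hfund_of_linSubstRep_eq_diagonal [CharZero k] (f : MvPolynomial σ k) (h₀ : GL σ k)
    (c : σ → k) (hc : ∀ u, c u ≠ 0)
    (h : linSubstRep σ k h₀ f = ∑ u, c u • (X u : MvPolynomial σ k) ^ 2) (t : σ) :
    HasHighestWeight (orbitCoordRep f 2) (fun v => if t ≤ v then (-2 : ℤ) else 0) := by
  have hf := eq_quadric_of_linSubstRep_eq_diagonal f h₀ c h
  set S₀ : Matrix σ σ k := ((h₀⁻¹ : GL σ k) : Matrix σ σ k) * Matrix.diagonal c *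
      ((h₀⁻¹ : GL σ k) : Matrix σ σ k)ᵀ with hS₀
  subst hf
  rw [hasHighestWeight_iff_exists]
  refine ⟨_, ?_, minorPoly_mem_highestWeightSpace S₀ t⟩
  intro h0
  rw [Ideal.Quotient.eq_zero_iff_mem, mem_orbitVanishingIdeal_iff] at h0
  have h1 := h0 h₀
  rw [h, aeval_formCoeff_diagonal_minorPoly] at h1
  exact (Finset.prod_ne_zero_iff.mpr fun u _ => mul_ne_zero two_ne_zero (hc u.1)) h1

/-- **hfund for `tr X_n²`** (characteristic zero): every fundamental even weight `-2·𝟙_{≥ t}`,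
`t` a letter of `MatIdx n`, occurs in `k[Δ_2(tr X_n²)]` — hypothesis `hfund` of
`rowTwo_bound_of_sign_of_fund` DISCHARGED (with `h₀` from `exists_gl_powFormLex_two_eq_diagonal`).
[folklore] -/
theorem hfund_powFormLex_two (k : Type*) [Field k] [CharZero k] (n : ℕ) (t : MatIdx n) :
    HasHighestWeight (orbitCoordRep (powFormLex k n 2) 2) (fun v => if t ≤ v then (-2 : ℤ) else 0) := by
  obtain ⟨h₀, hh₀⟩ := exists_gl_powFormLex_two_eq_diagonal k n
  refine hfund_of_linSubstRep_eq_diagonal (powFormLex k n 2) h₀ _ (fun u => ?_) hh₀ t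
  split_ifs <;> norm_num

/-- **Row `m = 2` of K2 modulo Borel density alone**: with `hsign` (`…TraceTwoDiagonal`) and
`hfund` (this file) discharged at the SAME `h₀`, the K2 bound at `m = 2` with exponent `c + 1`
holds for every generator type as soon as the Borel translates of `h₀ · tr X_n²` are dense
(`hdense`, the Cholesky density — the one remaining input of the row). [folklore] -/
theorem rowTwo_bound_of_dense (c e : ℕ) (h₀ : GL (MatIdx (2 + e)) ℂ)
    (hh₀ : linSubstRep (MatIdx (2 + e)) ℂ h₀ (powFormLex ℂ (2 + e) 2) =
      ∑ u : MatIdx (2 + e),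
        (if (toLex ((ofLex u).2, (ofLex u).1) : MatIdx (2 + e)) = u then (1 : ℂ)
          else if u < toLex ((ofLex u).2, (ofLex u).1) then 2 else -2) •
          (X u : MvPolynomial (MatIdx (2 + e)) ℂ) ^ 2)
    (hdense : ∀ x : OrbitCoordRing (powFormLex ℂ (2 + e) 2) 2,
      (∀ b : GL (MatIdx (2 + e)) ℂ, IsUpperTriangular b →
        evalAtPoint (powFormLex ℂ (2 + e) 2) 2
          (orbitCoordRep (powFormLex ℂ (2 + e) 2) 2 (b * h₀)⁻¹ x) = 0) → x = 0)
    (hwin : 2 + e ≤ 2 ^ ((Nat.log 2 2 + c) ^ c)) (χ : Weight (MatIdx (2 + e)))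
    (hγ : Module.finrank ℂ
      (↥(highestWeightSpace (orbitCoordRep (powFormLex ℂ (2 + e) 2) 2) χ) ⧸
        Submodule.comap (highestWeightSpace (orbitCoordRep (powFormLex ℂ (2 + e) 2) 2) χ).subtype
          (⨆ p : Weight (MatIdx (2 + e)) × Weight (MatIdx (2 + e)),
            ⨆ (_ : p.1 + p.2 = χ ∧ p.1 ≠ 0 ∧ p.2 ≠ 0),
              highestWeightSpace (orbitCoordRep (powFormLex ℂ (2 + e) 2) 2) p.1 *
                highestWeightSpace (orbitCoordRep (powFormLex ℂ (2 + e) 2) 2) p.2)) ≠ 0) :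
    -(Weight.size χ) ≤ ((2 : ℕ) : ℤ) * 2 ^ ((Nat.log 2 2 + (c + 1)) ^ (c + 1)) :=
  rowTwo_bound_of_sign_of_fund c e h₀ hdense
    (fun u => hsign_of_linSubstRep_eq_diagonal _ h₀ _ hh₀ u)
    (fun t => hfund_powFormLex_two ℂ (2 + e) t) hwin χ hγ

end Minors

end

end Summit.ValiantsHypothesis.ValiantsHypothesis.Theorems.GeneratorObstructions.PowGenDegreeQP
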